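import Literature.Analysis.FluidPDE.MVWeakStrongUniqueness
import Literature.Analysis.FluidPDE.MVRelativeEnergyInequality
import Literature.Analysis.FluidPDE.MVEntropyMinimum
import Literature.Analysis.FluidPDE.MVRelativeEnergyMaster
import Literature.Analysis.FluidPDE.IntegralGronwallZero
import HarnessLib

/-!
# Weak–strong uniqueness for dissipative measure-valued solutions of the full Euler system:
# the Gronwall argument (Březina–Feireisl 2018, §3.2.2, end of the proof of Theorem 3.3)

With the relative-energy inequality (`relEnergy_inequality`), the minimum principle
(`ae_entropy_ge`, giving `ℰ ≤ ℰ_Z`), the master pointwise inequality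
(`master_pointwise_inequality`, giving `⟨Y; reducedRHS_Z⟩ ≤ C ⟨Y; ℰ⟩`) and `∫_𝕋³ div(p U) = 0`,
the function `F = ∫⟨Y;ℰ⟩dx + D` satisfies `F(τ) ≤ K ∫₀^τ F` a.e.; the integral Gronwall lemma
(`ae_eq_zero_of_le_integral`) gives `F = 0` a.e., whence `D = 0` a.e. and, by strict coercivity of
`ℰ`, `Y_{t,x} = δ_{(ρ, ρe, ρu)(t,x)}` for a.e. `(t,x)`. This is `weakStrong_core`, the content of
BF Theorem 3.3 for solutions carried by the open quadrant; the final repackaging into the statement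
`brezinaFeireisl2018_thm_3_3` is `brezinaFeireisl2018_thm_3_3_holds` at the end of this file.

## References

* J. Březina, E. Feireisl, J. Math. Soc. Japan 70 (2018), Thm. 3.3, §3.2.2.
-/

noncomputable section

open Set Function MeasureTheory ProbabilityTheory Filter
open scoped BigOperators ENNReal Topology InnerProductSpace

namespace Literature.Analysis.FluidPDE

namespace CompressibleEuler

open Literature.Analysis.FunctionSpaces EulerPhase StrongPointData EulerEOS
open Literature.Analysis.FunctionSpaces.Torus hiding kineticEnergy

variable {eos : EulerEOS} {T T₁ : ℝ} {ρ : ℝ → UnitAddTorus (Fin 3) → ℝ}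
  {u : ℝ → UnitAddTorus (Fin 3) → EuclideanSpace ℝ (Fin 3)} {ϑ : ℝ → UnitAddTorus (Fin 3) → ℝ}
  {Y : Kernel (ℝ × UnitAddTorus (Fin 3)) EulerPhase} {D : ℝ → ℝ}

/-- `∫_{(0,τ)×𝕋³} (p divU + U·∇p)(r,Θ) = 0` (each time slice is `∫_𝕋³ div(pU) = 0`).
[cite: BrezinaFeireisl2018, §3.2.2 Step 1] -/
theorem setIntegral_divPU_eq_zero (h : IsClassicalEulerSolution eos T₁ ρ u ϑ) (hG : eos.IsGibbs)
    (hTT₁ : T < T₁) {M : ℝ} (hB : ∀ t ∈ Icc (0 : ℝ) T, ∀ x, (pdAt T₁ ρ u ϑ (t, x)).Bounded M)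
    {N : ℝ} (hN : CoeffBound eos T₁ ρ u ϑ T N) {τ : ℝ} (hτ : τ ∈ Ioo 0 T) :
    IntegrableOn (fun z => divPU eos (pdAt T₁ ρ u ϑ z)) (Ioo 0 τ ×ˢ univ) volume ∧
    ∫ z in Ioo 0 τ ×ˢ univ, divPU eos (pdAt T₁ ρ u ϑ z) = 0 := by
  have hM0 : 0 ≤ M := (abs_nonneg _).trans (hB 0 ⟨le_rfl, hτ.1.le.trans hτ.2.le⟩ 0).1
  have hN0 : 0 ≤ N := (abs_nonneg _).trans (hN 0 ⟨le_rfl, hτ.1.le.trans hτ.2.le⟩ 0).2.1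
  -- continuity on `(0,T₁) × 𝕋³`
  obtain ⟨cr, cΘ, -, -, cU, -, cgr, cgΘ, -⟩ := h.continuousOn_pointData_base
  obtain ⟨cpρ, cpϑ, -, cp, -⟩ := h.continuousOn_pointData_thermo hG
  obtain ⟨-, -, -, cdivU⟩ := h.continuousOn_coeffs hG
  have hc : ContinuousOn (fun z => divPU eos (pdAt T₁ ρ u ϑ z)) (Ioo 0 T₁ ×ˢ univ) := by
    simp only [divPU, gp]
    exact (cp.mul cdivU).add (continuousOn_finsetSum _ fun j _ =>
      (cU j).mul ((cpρ.mul (cgr j)).add (cpϑ.mul (cgΘ j))))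
  have hmeasS : MeasurableSet (Ioo (0 : ℝ) τ ×ˢ (univ : Set (UnitAddTorus (Fin 3)))) :=
    measurableSet_Ioo.prod MeasurableSet.univ
  have hSsub : Ioo (0 : ℝ) τ ×ˢ (univ : Set (UnitAddTorus (Fin 3))) ⊆ Ioo 0 T₁ ×ˢ univ :=
    prod_mono (Ioo_subset_Ioo_right (hτ.2.le.trans hTT₁.le)) subset_rfl
  -- the bound `|divPU| ≤ 6 M N`
  have hbd : ∀ z ∈ Ioo (0 : ℝ) τ ×ˢ (univ : Set (UnitAddTorus (Fin 3))),
      |divPU eos (pdAt T₁ ρ u ϑ z)| ≤ 6 * M * N := by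
    intro z hz
    have ht : z.1 ∈ Icc (0 : ℝ) T := ⟨hz.1.1.le, hz.1.2.le.trans hτ.2.le⟩
    have hb := hB z.1 ht z.2
    have hn := hN z.1 ht z.2
    have h1 : |eos.p (pdAt T₁ ρ u ϑ z).r (pdAt T₁ ρ u ϑ z).Θ * (pdAt T₁ ρ u ϑ z).divU| ≤ N * (3 * M) := by
      rw [abs_mul]; exact mul_le_mul hn.2.1 hb.abs_divU_le (abs_nonneg _) hN0
    have h2 : |∑ j, (pdAt T₁ ρ u ϑ z).U j * (pdAt T₁ ρ u ϑ z).gp eos j| ≤ 3 * (M * N) := by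
      calc _ ≤ ∑ j, |(pdAt T₁ ρ u ϑ z).U j * (pdAt T₁ ρ u ϑ z).gp eos j| := Finset.abs_sum_le_sum_abs _ _
        _ ≤ ∑ _j : Fin 3, M * N := Finset.sum_le_sum fun j _ => by
            rw [abs_mul]; exact mul_le_mul (hb.2.2.1 j) (hn.2.2.2.2.2.2 j) (abs_nonneg _) hM0
        _ = 3 * (M * N) := by simp
    unfold divPU
    calc _ ≤ |eos.p (pdAt T₁ ρ u ϑ z).r (pdAt T₁ ρ u ϑ z).Θ * (pdAt T₁ ρ u ϑ z).divU| +
        |∑ j, (pdAt T₁ ρ u ϑ z).U j * (pdAt T₁ ρ u ϑ z).gp eos j| := abs_add_le _ _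
      _ ≤ _ := by linarith
  have hint : IntegrableOn (fun z => divPU eos (pdAt T₁ ρ u ϑ z)) (Ioo 0 τ ×ˢ univ) volume := by
    refine IntegrableOn.of_bound ?_ ((hc.mono hSsub).aestronglyMeasurable hmeasS) (6 * M * N) ?_
    · rw [Measure.volume_eq_prod, Measure.prod_prod]
      exact ENNReal.mul_lt_top measure_Ioo_lt_top (measure_lt_top _ _)
    · rw [ae_restrict_iff' hmeasS]
      exact Eventually.of_forall fun z hz => by rw [Real.norm_eq_abs]; exact hbd z hz
  refine ⟨hint, ?_⟩
  rw [Measure.volume_eq_prod, setIntegral_prod _ (by rw [← Measure.volume_eq_prod]; exact hint)]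
  simp only [Measure.restrict_univ]
  refine setIntegral_eq_zero_of_forall_eq_zero fun t ht => ?_
  have ht₁ : t ∈ Ico 0 T₁ := ⟨ht.1.le, ht.2.trans (hτ.2.trans hTT₁)⟩
  obtain ⟨hdiv, hzero⟩ := h.div_pressure_flux hG ht₁
  rw [← hzero]
  refine integral_congr_ae (Eventually.of_forall fun x => ?_)
  rw [hdiv x]
  rfl

section Core

/-- Positivity facts along the solution and on the quadrant: `ℰ ≥ 0` fibrewise and
`G ≥ 0` on `[0,T₁) × 𝕋³`. [folklore] -/
theorem relEnergyFull_nonneg_pd (hG : eos.IsGibbs) (hS : eos.IsThermodynamicallyStable)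
    (htemp : ∀ r E : ℝ, 0 < r → 0 < E → 0 < eos.temperature r E ∧ r * eos.e r (eos.temperature r E) = E)
    (h : IsClassicalEulerSolution eos T₁ ρ u ϑ) (hsupp : ∀ z, ∀ᵐ w ∂(Y z), w ∈ phaseQuadrant)
    {z : ℝ × UnitAddTorus (Fin 3)} (hz : z.1 ∈ Ico (0 : ℝ) T₁) :
    (∀ w ∈ phaseQuadrant, 0 ≤ relEnergyFull eos (pdAt T₁ ρ u ϑ z) (dens w) (ien w) (mom w)) ∧
    0 ≤ avgRelEnergy eos T₁ ρ u ϑ Y z := by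
  have hr := h.density_pos z.1 hz z.2
  have hΘ := h.temperature_pos z.1 hz z.2
  have h1 : ∀ w ∈ phaseQuadrant, 0 ≤ relEnergyFull eos (pdAt T₁ ρ u ϑ z) (dens w) (ien w) (mom w) :=
    fun w hw => relEnergyFull_nonneg hG hS _ hr hΘ hw.1 (htemp _ _ hw.1 hw.2).1 (mom w)
  exact ⟨h1, integral_nonneg_of_ae ((hsupp z).mono fun w hw => h1 w hw)⟩

/-- **Integrability of the averaged relative energy** on `(0,T) × 𝕋³` and the comparison
`G ≤ G_Z` a.e., given the minimum principle `s ≥ a` (product-a.e. form).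
[cite: BrezinaFeireisl2018, §3.1.1] -/
theorem integrable_avgRelEnergy (hG : eos.IsGibbs) (hS : eos.IsThermodynamicallyStable)
    (htemp : ∀ r E : ℝ, 0 < r → 0 < E → 0 < eos.temperature r E ∧ r * eos.e r (eos.temperature r E) = E)
    (h : IsClassicalEulerSolution eos T₁ ρ u ϑ) (hT : 0 < T) (hTT₁ : T < T₁)
    (hMV : IsDissipativeMVSolution eos.toConservative T Y D)
    (hsupp : ∀ z, ∀ᵐ w ∂(Y z), w ∈ phaseQuadrant)
    {a b : ℝ} (hab : a ≤ b)
    (hsminP : ∀ᵐ z ∂((volume : Measure (ℝ × UnitAddTorus (Fin 3))).restrict (Ioo 0 T ×ˢ univ)),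
      ∀ᵐ w ∂(Y z), a ≤ eos.s (dens w) (stateTemp eos (dens w) (ien w)))
    {M : ℝ} (hB : ∀ t ∈ Icc (0 : ℝ) T, ∀ x, (pdAt T₁ ρ u ϑ (t, x)).Bounded M)
    {N : ℝ} (hN : CoeffBound eos T₁ ρ u ϑ T N) :
    (∀ᵐ z ∂((volume : Measure (ℝ × UnitAddTorus (Fin 3))).restrict (Ioo 0 T ×ˢ univ)),
      Integrable (fun w => relEnergyFull eos (pdAt T₁ ρ u ϑ z) (dens w) (ien w) (mom w)) (Y z)) ∧
    Integrable (avgRelEnergy eos T₁ ρ u ϑ Y)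
      ((volume : Measure (ℝ × UnitAddTorus (Fin 3))).restrict (Ioo 0 T ×ˢ univ)) ∧
    (∀ᵐ z ∂((volume : Measure (ℝ × UnitAddTorus (Fin 3))).restrict (Ioo 0 T ×ˢ univ)),
      avgRelEnergy eos T₁ ρ u ϑ Y z ≤ avgRelEnergyZ eos T₁ ρ u ϑ Y a b z) := by
  classical
  haveI := hMV.markov
  have hZ : IsEntropyCutoff (clamp a b) := isEntropyCutoff_clamp hab
  obtain ⟨Zb, hZb⟩ := hZ.2.2
  have hZb0 : 0 ≤ Zb := (abs_nonneg _).trans (hZb 0)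
  have hM0 : 0 ≤ M := (abs_nonneg _).trans (hB 0 ⟨le_rfl, hT.le⟩ 0).1
  have hN0 : 0 ≤ N := (abs_nonneg _).trans (hN 0 ⟨le_rfl, hT.le⟩ 0).2.1
  obtain ⟨-, -, -, crelZ, -, cfull, -⟩ := h.continuousOn_integrands hG hS htemp hZ.1
  have memT : ∀ z ∈ Ioo (0 : ℝ) T ×ˢ (univ : Set (UnitAddTorus (Fin 3))), z.1 ∈ Icc (0 : ℝ) T :=
    fun z hz => ⟨hz.1.1.le, hz.1.2.le⟩
  have memT₁ : ∀ z ∈ Ioo (0 : ℝ) T ×ˢ (univ : Set (UnitAddTorus (Fin 3))), z.1 ∈ Ico (0 : ℝ) T₁ :=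
    fun z hz => ⟨hz.1.1.le, hz.1.2.trans hTT₁⟩
  have iZ := spacetime_integrable hG hS htemp hMV hsupp hTT₁.le crelZ (A := 2 + 3 * M + N + N * Zb) (B := N)
    (by positivity) hN0 fun z hz w hw => by
      have hn := hN z.1 (memT z hz) z.2
      refine (abs_relEnergyZ_le hw (hB z.1 (memT z hz) z.2) hZb hn.1 hn.2.1).trans ?_
      have hΦ := momentFun_nonneg (ceos := eos.toConservative) hw
      have : |(pdAt T₁ ρ u ϑ z).Θ| * Zb ≤ N * Zb := mul_le_mul_of_nonneg_right hn.2.2.1 hZb0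
      nlinarith
  have hmeasST : MeasurableSet (Ioo (0 : ℝ) T ×ˢ (univ : Set (UnitAddTorus (Fin 3)))) :=
    measurableSet_Ioo.prod MeasurableSet.univ
  have hmemST : ∀ᵐ z ∂((volume : Measure (ℝ × UnitAddTorus (Fin 3))).restrict (Ioo 0 T ×ˢ univ)),
      z ∈ Ioo (0 : ℝ) T ×ˢ (univ : Set (UnitAddTorus (Fin 3))) := ae_restrict_mem hmeasST
  -- `0 ≤ ℰ ≤ ℰ_Z` fibrewise
  have hLe : ∀ᵐ z ∂((volume : Measure (ℝ × UnitAddTorus (Fin 3))).restrict (Ioo 0 T ×ˢ univ)),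
      ∀ᵐ w ∂(Y z), 0 ≤ relEnergyFull eos (pdAt T₁ ρ u ϑ z) (dens w) (ien w) (mom w) ∧
        relEnergyFull eos (pdAt T₁ ρ u ϑ z) (dens w) (ien w) (mom w) ≤
          (pdAt T₁ ρ u ϑ z).relEnergyZ eos (clamp a b) w := by
    filter_upwards [hsminP, hmemST] with z hz hzm
    have hp := (relEnergyFull_nonneg_pd hG hS htemp h hsupp (memT₁ z hzm)).1
    have hr := h.density_pos z.1 (memT₁ z hzm) z.2
    have hΘ := h.temperature_pos z.1 (memT₁ z hzm) z.2
    filter_upwards [hz, hsupp z] with w hw hwq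
    exact ⟨hp w hwq, relEnergyFull_le_relEnergyZ_of_entropy_ge _ hr hΘ.le hwq (htemp _ _ hwq.1 hwq.2).2 hw⟩
  have hFullInt : ∀ᵐ z ∂((volume : Measure (ℝ × UnitAddTorus (Fin 3))).restrict (Ioo 0 T ×ˢ univ)),
      Integrable (fun w => relEnergyFull eos (pdAt T₁ ρ u ϑ z) (dens w) (ien w) (mom w)) (Y z) := by
    filter_upwards [iZ.1, hLe] with z hz hle
    have hcont := continuousOn_relEnergyFull_fibre hG hS htemp (pdAt T₁ ρ u ϑ z)
    refine Integrable.mono' hz (aestronglyMeasurable_of_continuousOn_of_ae_mem hcont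
      measurableSet_phaseQuadrant (hsupp z)) ?_
    filter_upwards [hle] with w hw
    rw [Real.norm_eq_abs, abs_of_nonneg hw.1]; exact hw.2
  have hGle : ∀ᵐ z ∂((volume : Measure (ℝ × UnitAddTorus (Fin 3))).restrict (Ioo 0 T ×ˢ univ)),
      avgRelEnergy eos T₁ ρ u ϑ Y z ≤ avgRelEnergyZ eos T₁ ρ u ϑ Y a b z := by
    filter_upwards [iZ.1, hLe, hFullInt] with z hz hle hfi
    exact integral_mono_ae hfi hz (hle.mono fun w hw => hw.2)
  have hGmeas : AEStronglyMeasurable (avgRelEnergy eos T₁ ρ u ϑ Y)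
      ((volume : Measure (ℝ × UnitAddTorus (Fin 3))).restrict (Ioo 0 T ×ˢ univ)) := by
    have hunc : Measurable (uncurry fun (z : ℝ × UnitAddTorus (Fin 3)) (w : EulerPhase) => (goodSet T₁).piecewise
        (fun q => relEnergyFull eos (pdAt T₁ ρ u ϑ q.1) (dens q.2) (ien q.2) (mom q.2)) 0 (z, w)) := by
      have : (uncurry fun (z : ℝ × UnitAddTorus (Fin 3)) (w : EulerPhase) => (goodSet T₁).piecewise
          (fun q => relEnergyFull eos (pdAt T₁ ρ u ϑ q.1) (dens q.2) (ien q.2) (mom q.2)) 0 (z, w)) =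
          (goodSet T₁).piecewise
            (fun q => relEnergyFull eos (pdAt T₁ ρ u ϑ q.1) (dens q.2) (ien q.2) (mom q.2)) 0 := by
        funext q; rfl
      rw [this]; exact measurable_modify cfull
    have hsm : StronglyMeasurable fun z : ℝ × UnitAddTorus (Fin 3) => ∫ w, (goodSet T₁).piecewise
        (fun q => relEnergyFull eos (pdAt T₁ ρ u ϑ q.1) (dens q.2) (ien q.2) (mom q.2)) 0 (z, w) ∂(Y z) :=
      hunc.stronglyMeasurable.integral_kernel_prod_right
    refine ⟨_, hsm, ?_⟩
    filter_upwards [hmemST] with z hzm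
    refine integral_congr_ae ((hsupp z).mono fun w hw => ?_)
    have hmem : (z, w) ∈ goodSet T₁ := ⟨⟨⟨hzm.1.1, hzm.1.2.trans hTT₁⟩, mem_univ _⟩, hw⟩
    simp [Set.piecewise, hmem]
  have hGint : Integrable (avgRelEnergy eos T₁ ρ u ϑ Y)
      ((volume : Measure (ℝ × UnitAddTorus (Fin 3))).restrict (Ioo 0 T ×ˢ univ)) := by
    refine Integrable.mono' iZ.2 hGmeas ?_
    filter_upwards [hGle, hmemST] with z hz hzm
    rw [Real.norm_eq_abs, abs_of_nonneg (relEnergyFull_nonneg_pd hG hS htemp h hsupp (memT₁ z hzm)).2]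
    exact hz
  exact ⟨hFullInt, hGint, hGle⟩

/-- **`∫G(τ,·) ≤ ∫G_Z(τ,·)` for a.e. `τ`** (iterated form of the minimum principle).
[cite: BrezinaFeireisl2018, §3.1.1] -/
theorem integral_avgRelEnergy_le (hG : eos.IsGibbs) (hS : eos.IsThermodynamicallyStable)
    (htemp : ∀ r E : ℝ, 0 < r → 0 < E → 0 < eos.temperature r E ∧ r * eos.e r (eos.temperature r E) = E)
    (h : IsClassicalEulerSolution eos T₁ ρ u ϑ) (hT : 0 < T) (hTT₁ : T < T₁)
    (hMV : IsDissipativeMVSolution eos.toConservative T Y D)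
    (hsupp : ∀ z, ∀ᵐ w ∂(Y z), w ∈ phaseQuadrant)
    {a b : ℝ} (hab : a ≤ b)
    (hsmin : ∀ᵐ τ ∂(volume.restrict (Ioo 0 T)), ∀ᵐ x ∂(volume : Measure (UnitAddTorus (Fin 3))),
      ∀ᵐ w ∂(Y (τ, x)), a ≤ eos.s (dens w) (stateTemp eos (dens w) (ien w)))
    {M : ℝ} (hB : ∀ t ∈ Icc (0 : ℝ) T, ∀ x, (pdAt T₁ ρ u ϑ (t, x)).Bounded M)
    {N : ℝ} (hN : CoeffBound eos T₁ ρ u ϑ T N) :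
    ∀ᵐ τ ∂(volume.restrict (Ioo 0 T)),
      ∫ x, avgRelEnergy eos T₁ ρ u ϑ Y (τ, x) ≤ ∫ x, avgRelEnergyZ eos T₁ ρ u ϑ Y a b (τ, x) := by
  haveI := hMV.markov
  have hZ : IsEntropyCutoff (clamp a b) := isEntropyCutoff_clamp hab
  obtain ⟨Zb, hZb⟩ := hZ.2.2
  have hZb0 : 0 ≤ Zb := (abs_nonneg _).trans (hZb 0)
  have hM0 : 0 ≤ M := (abs_nonneg _).trans (hB 0 ⟨le_rfl, hT.le⟩ 0).1
  have hN0 : 0 ≤ N := (abs_nonneg _).trans (hN 0 ⟨le_rfl, hT.le⟩ 0).2.1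
  obtain ⟨-, -, -, crelZ, -⟩ := h.continuousOn_integrands hG hS htemp hZ.1
  obtain ⟨Cm, hCm, hmomb⟩ := hMV.moment_bound
  filter_upwards [hsmin, hmomb, ae_restrict_mem measurableSet_Ioo] with τ hs e5 hτ
  have hτ₁ : τ ∈ Ioo 0 T₁ := ⟨hτ.1, hτ.2.trans hTT₁⟩
  have hτT : τ ∈ Icc 0 T := ⟨hτ.1.le, hτ.2.le⟩
  have i0 := slice_integrable hG hS htemp hsupp hτ₁ hCm e5 crelZ (A := 2 + 3 * M + N + N * Zb) (B := N)
    (by positivity) hN0 fun x w hw => by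
      have hn := hN τ hτT x
      refine (abs_relEnergyZ_le hw (hB τ hτT x) hZb hn.1 hn.2.1).trans ?_
      have hΦ := momentFun_nonneg (ceos := eos.toConservative) hw
      have : |(pdAt T₁ ρ u ϑ (τ, x)).Θ| * Zb ≤ N * Zb := mul_le_mul_of_nonneg_right hn.2.2.1 hZb0
      nlinarith
  have hp := fun x => relEnergyFull_nonneg_pd (z := (τ, x)) hG hS htemp h hsupp (Ioo_subset_Ico_self hτ₁)
  refine integral_mono_of_nonneg (Eventually.of_forall fun x => (hp x).2) i0.2.1 ?_
  filter_upwards [hs, i0.1] with x hx hix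
  refine integral_mono_of_nonneg ((hsupp (τ, x)).mono fun w hw => (hp x).1 w hw) hix ?_
  have hr := h.density_pos τ (Ioo_subset_Ico_self hτ₁) x
  have hΘ := h.temperature_pos τ (Ioo_subset_Ico_self hτ₁) x
  filter_upwards [hx, hsupp (τ, x)] with w hw hwq
  exact relEnergyFull_le_relEnergyZ_of_entropy_ge _ hr hΘ.le hwq (htemp _ _ hwq.1 hwq.2).2 hw

/-- **The right-hand side is controlled by `G`**: `⟨Y_z; rawRHS_Z⟩ + divPU(z) ≤ C G(z)` for a.e.
`z ∈ (0,T) × 𝕋³` (Step 1 identity + master pointwise inequality, integrated against `Y_z`).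
[cite: BrezinaFeireisl2018, §3.2.2] -/
theorem avg_rawRHS_le (hG : eos.IsGibbs) (hS : eos.IsThermodynamicallyStable)
    (htemp : ∀ r E : ℝ, 0 < r → 0 < E → 0 < eos.temperature r E ∧ r * eos.e r (eos.temperature r E) = E)
    (h : IsClassicalEulerSolution eos T₁ ρ u ϑ) (hT : 0 < T) (hTT₁ : T < T₁)
    (hMV : IsDissipativeMVSolution eos.toConservative T Y D)
    (hsupp : ∀ z, ∀ᵐ w ∂(Y z), w ∈ phaseQuadrant)
    {a b C₁ : ℝ} (hab : a ≤ b)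
    {M : ℝ} (hB : ∀ t ∈ Icc (0 : ℝ) T, ∀ x, (pdAt T₁ ρ u ϑ (t, x)).Bounded M)
    {N : ℝ} (hN : CoeffBound eos T₁ ρ u ϑ T N)
    (hmaster : ∀ d : StrongPointData,
      (d.r, d.Θ) ∈ (fun z : ℝ × UnitAddTorus (Fin 3) => (ρ z.1 z.2, ϑ z.1 z.2)) '' (Icc 0 T ×ˢ univ) →
      d.Bounded M → d.MassEq → d.TemperatureEq eos →
        ∀ (ρ' E : ℝ) (m : EuclideanSpace ℝ (Fin 3)), 0 < ρ' → 0 < stateTemp eos ρ' E →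
          reducedRHS eos (clamp a b) d ρ' E m ≤ C₁ * relEnergyFull eos d ρ' E m)
    (hFullInt : ∀ᵐ z ∂((volume : Measure (ℝ × UnitAddTorus (Fin 3))).restrict (Ioo 0 T ×ˢ univ)),
      Integrable (fun w => relEnergyFull eos (pdAt T₁ ρ u ϑ z) (dens w) (ien w) (mom w)) (Y z)) :
    IntegrableOn (fun z => ∫ w, rawRHS eos (clamp a b) (pdAt T₁ ρ u ϑ z) (dens w) (ien w) (mom w) ∂(Y z))
      (Ioo 0 T ×ˢ univ) volume ∧
    ∀ᵐ z ∂((volume : Measure (ℝ × UnitAddTorus (Fin 3))).restrict (Ioo 0 T ×ˢ univ)),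
      (∫ w, rawRHS eos (clamp a b) (pdAt T₁ ρ u ϑ z) (dens w) (ien w) (mom w) ∂(Y z)) +
        divPU eos (pdAt T₁ ρ u ϑ z) ≤ C₁ * avgRelEnergy eos T₁ ρ u ϑ Y z := by
  haveI := hMV.markov
  haveI : ∀ z, IsProbabilityMeasure (Y z) := fun z => IsMarkovKernel.isProbabilityMeasure z
  have hZ : IsEntropyCutoff (clamp a b) := isEntropyCutoff_clamp hab
  obtain ⟨Zb, hZb⟩ := hZ.2.2
  have hZb0 : 0 ≤ Zb := (abs_nonneg _).trans (hZb 0)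
  have hM0 : 0 ≤ M := (abs_nonneg _).trans (hB 0 ⟨le_rfl, hT.le⟩ 0).1
  have hN0 : 0 ≤ N := (abs_nonneg _).trans (hN 0 ⟨le_rfl, hT.le⟩ 0).2.1
  obtain ⟨-, -, -, -, craw, -⟩ := h.continuousOn_integrands hG hS htemp hZ.1
  have memT : ∀ z ∈ Ioo (0 : ℝ) T ×ˢ (univ : Set (UnitAddTorus (Fin 3))), z.1 ∈ Icc (0 : ℝ) T :=
    fun z hz => ⟨hz.1.1.le, hz.1.2.le⟩
  have iR := spacetime_integrable hG hS htemp hMV hsupp hTT₁.le craw (A := 12 * M + 4 * N + 4 * Zb * M) (B := N)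
    (by positivity) hN0 fun z hz w hw =>
      abs_rawRHS_le hw (hB z.1 (memT z hz) z.2) hZb (hN z.1 (memT z hz) z.2).2.2.2.2.1
        (hN z.1 (memT z hz) z.2).2.2.2.2.2.1 (hN z.1 (memT z hz) z.2).2.2.2.1
  refine ⟨iR.2, ?_⟩
  have hmeasST : MeasurableSet (Ioo (0 : ℝ) T ×ˢ (univ : Set (UnitAddTorus (Fin 3)))) :=
    measurableSet_Ioo.prod MeasurableSet.univ
  filter_upwards [iR.1, hFullInt, ae_restrict_mem hmeasST] with z hraw hfi hzm
  have hz₁ : z.1 ∈ Ico (0 : ℝ) T₁ := ⟨hzm.1.1.le, hzm.1.2.trans hTT₁⟩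
  have hr := h.density_pos z.1 hz₁ z.2
  have hmomEq : (pdAt T₁ ρ u ϑ z).MomentumEq eos := h.momentumEq_pointData hG hz₁ z.2
  have hmassEq : (pdAt T₁ ρ u ϑ z).MassEq := h.massEq_pointData hz₁ z.2
  have htempEq : (pdAt T₁ ρ u ϑ z).TemperatureEq eos := h.temperatureEq_pointData hG hz₁ z.2
  have hdK : ((pdAt T₁ ρ u ϑ z).r, (pdAt T₁ ρ u ϑ z).Θ) ∈
      (fun z : ℝ × UnitAddTorus (Fin 3) => (ρ z.1 z.2, ϑ z.1 z.2)) '' (Icc 0 T ×ˢ univ) :=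
    ⟨z, ⟨memT z hzm, mem_univ _⟩, rfl⟩
  have e1 : (∫ w, rawRHS eos (clamp a b) (pdAt T₁ ρ u ϑ z) (dens w) (ien w) (mom w) ∂(Y z)) +
      divPU eos (pdAt T₁ ρ u ϑ z) =
      ∫ w, (rawRHS eos (clamp a b) (pdAt T₁ ρ u ϑ z) (dens w) (ien w) (mom w) +
        divPU eos (pdAt T₁ ρ u ϑ z)) ∂(Y z) := by
    rw [integral_add hraw (integrable_const _)]
    simp [integral_const]
  rw [e1]
  unfold avgRelEnergy
  rw [← integral_const_mul]
  refine integral_mono_ae (hraw.add (integrable_const _)) (hfi.const_mul C₁) ?_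
  filter_upwards [hsupp z] with w hw
  have := hmaster (pdAt T₁ ρ u ϑ z) hdK (hB z.1 (memT z hzm) z.2) hmassEq htempEq (dens w) (ien w) (mom w)
    hw.1 (htemp _ _ hw.1 hw.2).1
  rw [← rawRHS_add_div_eq eos (clamp a b) (pdAt T₁ ρ u ϑ z) hw.1.ne' hr.ne' hmomEq] at this
  exact this

/-- **`∫_{(0,τ)×𝕋³} G = ∫₀^τ ∫_𝕋³ G`** (Fubini) for the integrable averaged relative energy. [folklore] -/
theorem setIntegral_avgRelEnergy_eq
    (hGint : Integrable (avgRelEnergy eos T₁ ρ u ϑ Y)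
      ((volume : Measure (ℝ × UnitAddTorus (Fin 3))).restrict (Ioo 0 T ×ˢ univ)))
    {τ : ℝ} (hτ : τ ∈ Ioo 0 T) :
    ∫ z in Ioo 0 τ ×ˢ univ, avgRelEnergy eos T₁ ρ u ϑ Y z =
      ∫ t in Ioo 0 τ, ∫ x, avgRelEnergy eos T₁ ρ u ϑ Y (t, x) := by
  have hsub : Ioo (0 : ℝ) τ ×ˢ (univ : Set (UnitAddTorus (Fin 3))) ⊆ Ioo 0 T ×ˢ univ :=
    prod_mono (Ioo_subset_Ioo_right hτ.2.le) subset_rfl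
  have hi : IntegrableOn (avgRelEnergy eos T₁ ρ u ϑ Y) (Ioo 0 τ ×ˢ univ)
      (volume : Measure (ℝ × UnitAddTorus (Fin 3))) :=
    IntegrableOn.mono_set (μ := volume) (t := Ioo 0 T ×ˢ univ) hGint hsub
  rw [Measure.volume_eq_prod] at hi ⊢
  rw [setIntegral_prod _ hi]
  simp only [Measure.restrict_univ]

end Core

/-- **BF Theorem 3.3, core statement** for a dissipative measure-valued solution carried by the
open quadrant with Dirac initial data given by a classical solution on `[0,T₁) ⊃ [0,T]`:
`D = 0` a.e. on `(0,T)` and `Y_{t,x} = δ_{(ρ, ρe(ρ,ϑ), ρu)(t,x)}` for a.e. `(t,x) ∈ (0,T) × 𝕋³`.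
[cite: BrezinaFeireisl2018, Thm. 3.3] -/
theorem weakStrong_core (hG : eos.IsGibbs) (hS : eos.IsThermodynamicallyStable)
    (hp2 : ContDiffOn ℝ 2 (uncurry eos.p) (Ioi 0 ×ˢ Ioi 0))
    (he2 : ContDiffOn ℝ 2 (uncurry eos.e) (Ioi 0 ×ˢ Ioi 0))
    (hs2 : ContDiffOn ℝ 2 (uncurry eos.s) (Ioi 0 ×ˢ Ioi 0))
    (he : ∀ r θ : ℝ, 0 < r → 0 < θ → 0 < eos.e r θ)
    (htemp : ∀ r E : ℝ, 0 < r → 0 < E →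
      0 < eos.temperature r E ∧ r * eos.e r (eos.temperature r E) = E)
    (hgrowth : ∃ c : ℝ, ∀ r θ : ℝ, 0 < r → 0 < θ →
      |eos.p r θ| ≤ c * (1 + r + r * |eos.s r θ| + r * eos.e r θ))
    (hT : 0 < T) (hTT₁ : T < T₁) (h : IsClassicalEulerSolution eos T₁ ρ u ϑ)
    (hMV : IsDissipativeMVSolution eos.toConservative T Y D)
    (hsupp : ∀ z, ∀ᵐ w ∂(Y z), w ∈ phaseQuadrant)
    (hY0 : ∀ᵐ x ∂(volume : Measure (UnitAddTorus (Fin 3))),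
      Y (0, x) = Measure.dirac (classicalState eos ρ u ϑ 0 x)) :
    (∀ᵐ τ ∂(volume.restrict (Ioo 0 T)), D τ = 0) ∧
      ∀ᵐ z ∂((volume.restrict (Ioo 0 T)).prod (volume : Measure (UnitAddTorus (Fin 3)))),
        Y z = Measure.dirac (classicalState eos ρ u ϑ z.1 z.2) := by
  classical
  haveI := hMV.markov
  haveI : ∀ z, IsProbabilityMeasure (Y z) := fun z => IsMarkovKernel.isProbabilityMeasure z
  -- (A) constants
  obtain ⟨hK, hKq⟩ := h.isCompact_range_thermo hTT₁
  obtain ⟨M, hM0, hB⟩ := h.exists_bound_pointData hTT₁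
  obtain ⟨δ, a, b, C₁, hδ, hab, hC₁, hsab, hmaster⟩ :=
    master_pointwise_inequality hG hS hp2 he2 hs2 he hgrowth hK hKq hM0
  have hmemK : ∀ t ∈ Icc (0 : ℝ) T, ∀ x,
      (ρ t x, ϑ t x) ∈ (fun z : ℝ × UnitAddTorus (Fin 3) => (ρ z.1 z.2, ϑ z.1 z.2)) '' (Icc 0 T ×ˢ univ) :=
    fun t ht x => ⟨(t, x), ⟨ht, mem_univ _⟩, rfl⟩
  have hsK : ∀ t ∈ Icc (0 : ℝ) T, ∀ x, a ≤ eos.s (ρ t x) (ϑ t x) ∧ eos.s (ρ t x) (ϑ t x) ≤ b :=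
    fun t ht x => hsab (ρ t x) (ϑ t x) (ρ t x) (ϑ t x) (hmemK t ht x) (by simp [hδ.le]) (by simp [hδ.le])
  obtain ⟨N, hN⟩ := h.exists_coeffBound hG hT.le hTT₁ hM0 hB
  -- (B) the cut-off
  have hZ : IsEntropyCutoff (clamp a b) := isEntropyCutoff_clamp hab.le
  have hZs : ∀ x, clamp a b (eos.s (ρ 0 x) (ϑ 0 x)) = eos.s (ρ 0 x) (ϑ 0 x) := fun x =>
    clamp_eq_self (hsK 0 ⟨le_rfl, hT.le⟩ x).1 (hsK 0 ⟨le_rfl, hT.le⟩ x).2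
  -- (C) the relative-energy inequality and (D) the minimum principle
  obtain ⟨μR, c, hmass, hineq⟩ := relEnergy_inequality hG hS htemp h hT hTT₁ hMV hsupp hY0 hZ hZs hB hN
  have hsmin := ae_entropy_ge hG hS htemp h hT hTT₁ hMV hsupp hY0 (a := a) fun x => (hsK 0 ⟨le_rfl, hT.le⟩ x).1
  have hsminP := ae_restrict_prod_of_ae_ae_entropy_ge (T := T) hG hS htemp hsupp hsmin
  -- (E) the averaged relative energy
  obtain ⟨hFullInt, hGint, -⟩ := integrable_avgRelEnergy hG hS htemp h hT hTT₁ hMV hsupp hab.le hsminP hB hN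
  have hEle := integral_avgRelEnergy_le hG hS htemp h hT hTT₁ hMV hsupp hab.le hsmin hB hN
  obtain ⟨iR, hRHSpt⟩ := avg_rawRHS_le hG hS htemp h hT hTT₁ hMV hsupp hab.le hB hN hmaster hFullInt
  have hmeasST : MeasurableSet (Ioo (0 : ℝ) T ×ˢ (univ : Set (UnitAddTorus (Fin 3)))) :=
    measurableSet_Ioo.prod MeasurableSet.univ
  have hmemST : ∀ᵐ z ∂((volume : Measure (ℝ × UnitAddTorus (Fin 3))).restrict (Ioo 0 T ×ˢ univ)),
      z ∈ Ioo (0 : ℝ) T ×ˢ (univ : Set (UnitAddTorus (Fin 3))) := ae_restrict_mem hmeasST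
  have memT₁ : ∀ z ∈ Ioo (0 : ℝ) T ×ˢ (univ : Set (UnitAddTorus (Fin 3))), z.1 ∈ Ico (0 : ℝ) T₁ :=
    fun z hz => ⟨hz.1.1.le, hz.1.2.trans hTT₁⟩
  -- the time functions `E`, `D`
  set E : ℝ → ℝ := fun t => ∫ x, avgRelEnergy eos T₁ ρ u ϑ Y (t, x) with hEdef
  have hE0 : ∀ t ∈ Ico (0 : ℝ) T₁, 0 ≤ E t := fun t ht =>
    integral_nonneg fun x => (relEnergyFull_nonneg_pd (z := (t, x)) hG hS htemp h hsupp ht).2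
  haveI : IsFiniteMeasure (volume.restrict (Ioo (0 : ℝ) T)) :=
    ⟨by rw [Measure.restrict_apply_univ]; exact measure_Ioo_lt_top⟩
  obtain ⟨hDmeas, CD, hDbd⟩ := hMV.defect
  have hDint : Integrable D (volume.restrict (Ioo (0 : ℝ) T)) :=
    Integrable.of_bound hDmeas CD (hDbd.mono fun t ht => by
      rw [Real.norm_eq_abs, abs_of_nonneg ht.1]; exact ht.2)
  have hD0 : ∀ᵐ t ∂(volume.restrict (Ioo (0 : ℝ) T)), 0 ≤ D t := hDbd.mono fun t ht => ht.1
  have hGint' : Integrable (avgRelEnergy eos T₁ ρ u ϑ Y)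
      ((volume.restrict (Ioo (0 : ℝ) T)).prod (volume : Measure (UnitAddTorus (Fin 3)))) := by
    rw [Measure.restrict_prod_eq_prod_univ, ← Measure.volume_eq_prod]; exact hGint
  have hEint : Integrable E (volume.restrict (Ioo (0 : ℝ) T)) := hGint'.integral_prod_left
  have hsetD : ∀ {τ : ℝ}, τ ∈ Ioo 0 T → 0 ≤ ∫ t in Ioo 0 τ, D t := fun hτ =>
    setIntegral_nonneg_ae measurableSet_Ioo (by
      have := (ae_restrict_iff' (measurableSet_Ioo (a := (0 : ℝ)) (b := T))).1 hD0
      exact this.mono fun t ht ht' => ht ⟨ht'.1, ht'.2.trans hτ.2⟩)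
  have hsetE : ∀ {τ : ℝ}, τ ∈ Ioo 0 T → 0 ≤ ∫ t in Ioo 0 τ, E t := fun hτ =>
    setIntegral_nonneg measurableSet_Ioo fun t ht => hE0 t ⟨ht.1.le, ht.2.trans (hτ.2.trans hTT₁)⟩
  -- (E4) the integral inequality for `F = E + D`
  set Kc : ℝ := max C₁ (M * max c 0) with hKc
  have hKc0 : 0 ≤ Kc := hC₁.le.trans (le_max_left _ _)
  have hFineq : ∀ᵐ τ ∂(volume.restrict (Ioo 0 T)),
      E τ + D τ ≤ Kc * ∫ t in Ioo 0 τ, (E t + D t) := by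
    have hRHS' := (ae_restrict_iff' hmeasST).1 hRHSpt
    filter_upwards [hineq, hmass, hEle, ae_restrict_mem measurableSet_Ioo] with τ h1 h2 h3 hτ
    obtain ⟨iP, hP0⟩ := setIntegral_divPU_eq_zero h hG hTT₁ hB hN hτ
    have hsub : Ioo (0 : ℝ) τ ×ˢ (univ : Set (UnitAddTorus (Fin 3))) ⊆ Ioo 0 T ×ˢ univ :=
      prod_mono (Ioo_subset_Ioo_right hτ.2.le) subset_rfl
    have iRτ : IntegrableOn (fun z => ∫ w, rawRHS eos (clamp a b) (pdAt T₁ ρ u ϑ z) (dens w) (ien w) (mom w) ∂(Y z))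
        (Ioo 0 τ ×ˢ univ) volume := iR.mono_set hsub
    have iGτ : IntegrableOn (avgRelEnergy eos T₁ ρ u ϑ Y) (Ioo 0 τ ×ˢ univ)
        (volume : Measure (ℝ × UnitAddTorus (Fin 3))) :=
      IntegrableOn.mono_set (μ := volume) (t := Ioo 0 T ×ˢ univ) hGint hsub
    have hR : (∫ z in Ioo 0 τ ×ˢ univ, ∫ w, rawRHS eos (clamp a b) (pdAt T₁ ρ u ϑ z) (dens w) (ien w) (mom w)
        ∂(Y z)) ≤ C₁ * ∫ t in Ioo 0 τ, E t := by
      have e1 : (∫ z in Ioo 0 τ ×ˢ univ, ∫ w, rawRHS eos (clamp a b) (pdAt T₁ ρ u ϑ z) (dens w) (ien w) (mom w)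
          ∂(Y z)) = ∫ z in Ioo 0 τ ×ˢ univ, ((∫ w, rawRHS eos (clamp a b) (pdAt T₁ ρ u ϑ z) (dens w) (ien w)
            (mom w) ∂(Y z)) + divPU eos (pdAt T₁ ρ u ϑ z)) := by
        rw [integral_add iRτ iP, hP0, add_zero]
      rw [e1, ← setIntegral_avgRelEnergy_eq hGint hτ, ← integral_const_mul]
      refine setIntegral_mono_on_ae (iRτ.add iP) (iGτ.const_mul C₁) (measurableSet_Ioo.prod MeasurableSet.univ) ?_
      filter_upwards [hRHS'] with z hz hzτ
      exact hz (hsub hzτ)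
    have hDτ := hsetD hτ
    have hEτ := hsetE hτ
    have hm : M * (μR.massUpTo τ).toReal ≤ M * max c 0 * ∫ t in Ioo 0 τ, D t := by
      have h2' : (μR.massUpTo τ).toReal ≤ max (c * ∫ t in Ioo 0 τ, D t) 0 := by
        rw [← ENNReal.toReal_ofReal']
        exact ENNReal.toReal_mono ENNReal.ofReal_ne_top h2
      have h3' : max (c * ∫ t in Ioo 0 τ, D t) 0 ≤ max c 0 * ∫ t in Ioo 0 τ, D t :=
        max_le (mul_le_mul_of_nonneg_right (le_max_left _ _) hDτ) (mul_nonneg (le_max_right _ _) hDτ)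
      rw [mul_assoc]
      exact mul_le_mul_of_nonneg_left (h2'.trans h3') hM0
    rw [integral_add (IntegrableOn.mono_set (μ := volume) (t := Ioo 0 T) hEint (Ioo_subset_Ioo_right hτ.2.le))
      (IntegrableOn.mono_set (μ := volume) (t := Ioo 0 T) hDint (Ioo_subset_Ioo_right hτ.2.le))]
    have k1 : C₁ * ∫ t in Ioo 0 τ, E t ≤ Kc * ∫ t in Ioo 0 τ, E t :=
      mul_le_mul_of_nonneg_right (le_max_left _ _) hEτ
    have k2 : M * max c 0 * ∫ t in Ioo 0 τ, D t ≤ Kc * ∫ t in Ioo 0 τ, D t :=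
      mul_le_mul_of_nonneg_right (le_max_right _ _) hDτ
    have h3' : E τ ≤ ∫ x, avgRelEnergyZ eos T₁ ρ u ϑ Y a b (τ, x) := h3
    have h1' : (∫ x, avgRelEnergyZ eos T₁ ρ u ϑ Y a b (τ, x)) + D τ ≤
        (∫ z in Ioo 0 τ ×ˢ univ, ∫ w, rawRHS eos (clamp a b) (pdAt T₁ ρ u ϑ z) (dens w) (ien w) (mom w) ∂(Y z)) +
          M * (μR.massUpTo τ).toReal := h1
    linarith
  -- (E5) Gronwall: `E + D = 0` a.e.
  have hF0 : ∀ᵐ t ∂(volume.restrict (Ioo (0 : ℝ) T)), 0 ≤ E t + D t := by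
    filter_upwards [hD0, ae_restrict_mem measurableSet_Ioo] with t ht ht'
    exact add_nonneg (hE0 t ⟨ht'.1.le, ht'.2.trans hTT₁⟩) ht
  have hFzero := ae_eq_zero_of_le_integral hKc0 (hEint.add hDint) hF0 hFineq
  -- (E6) conclusions
  have hDzero : ∀ᵐ τ ∂(volume.restrict (Ioo 0 T)), D τ = 0 := by
    filter_upwards [hFzero, hD0, ae_restrict_mem measurableSet_Ioo] with t ht hd ht'
    have := hE0 t ⟨ht'.1.le, ht'.2.trans hTT₁⟩
    have ht2 : E t + D t = 0 := ht
    linarith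
  have hEzero : ∀ᵐ τ ∂(volume.restrict (Ioo 0 T)), E τ = 0 := by
    filter_upwards [hFzero, hD0, ae_restrict_mem measurableSet_Ioo] with t ht hd ht'
    have := hE0 t ⟨ht'.1.le, ht'.2.trans hTT₁⟩
    have ht2 : E t + D t = 0 := ht
    linarith
  refine ⟨hDzero, ?_⟩
  have hGI : ∫ z, avgRelEnergy eos T₁ ρ u ϑ Y z
      ∂((volume.restrict (Ioo (0 : ℝ) T)).prod (volume : Measure (UnitAddTorus (Fin 3)))) = 0 := by
    rw [integral_prod _ hGint']
    exact integral_eq_zero_of_ae hEzero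
  have hGae0 : ∀ᵐ z ∂((volume.restrict (Ioo (0 : ℝ) T)).prod (volume : Measure (UnitAddTorus (Fin 3)))),
      avgRelEnergy eos T₁ ρ u ϑ Y z = 0 := by
    have hnn : 0 ≤ᵐ[(volume.restrict (Ioo (0 : ℝ) T)).prod (volume : Measure (UnitAddTorus (Fin 3)))]
        avgRelEnergy eos T₁ ρ u ϑ Y := by
      rw [Measure.restrict_prod_eq_prod_univ, ← Measure.volume_eq_prod]
      filter_upwards [hmemST] with z hzm
      exact (relEnergyFull_nonneg_pd hG hS htemp h hsupp (memT₁ z hzm)).2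
    exact (integral_eq_zero_iff_of_nonneg_ae hnn hGint').1 hGI
  have hrest : ∀ᵐ z ∂((volume.restrict (Ioo (0 : ℝ) T)).prod (volume : Measure (UnitAddTorus (Fin 3)))),
      Integrable (fun w => relEnergyFull eos (pdAt T₁ ρ u ϑ z) (dens w) (ien w) (mom w)) (Y z) ∧
        z ∈ Ioo (0 : ℝ) T ×ˢ (univ : Set (UnitAddTorus (Fin 3))) := by
    rw [Measure.restrict_prod_eq_prod_univ, ← Measure.volume_eq_prod]
    filter_upwards [hFullInt, hmemST] with z h1 h2
    exact ⟨h1, h2⟩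
  filter_upwards [hGae0, hrest] with z hz ⟨hfi, hzm⟩
  have hz₁ := memT₁ z hzm
  have hnn : 0 ≤ᵐ[Y z] fun w => relEnergyFull eos (pdAt T₁ ρ u ϑ z) (dens w) (ien w) (mom w) :=
    (hsupp z).mono fun w hw => (relEnergyFull_nonneg_pd hG hS htemp h hsupp hz₁).1 w hw
  have hae0 := (integral_eq_zero_iff_of_nonneg_ae hnn hfi).1 hz
  refine eq_dirac_of_ae_eq ?_
  filter_upwards [hae0, hsupp z] with w hw hwq
  have := eq_classicalState_of_relEnergyFull_eq_zero hG hS (pdAt T₁ ρ u ϑ z)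
    (h.density_pos z.1 hz₁ z.2) (h.temperature_pos z.1 hz₁ z.2) hwq
    (htemp _ _ hwq.1 hwq.2).1 (htemp _ _ hwq.1 hwq.2).2 hw
  rw [this]
  rfl

end CompressibleEuler

end Literature.Analysis.FluidPDE

/-!
# Proof of `brezinaFeireisl2018_thm_3_3` (weak (measure-valued)–strong uniqueness, full Euler)

The named fact `brezinaFeireisl2018_thm_3_3` of `MVWeakStrongUniqueness.lean` is discharged by
`weakStrong_core` (above, in this file), the formalisation of Březina–Feireisl's
relative-energy argument (J. Math. Soc. Japan 70 (2018), §3): ballistic free energy and uniform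
coercivity (`BallisticFreeEnergy*`), the pointwise identity and bounds for the right-hand side
(`MVRelativeEnergyPointwise*`, `MVRelativeEnergyMaster`), the strong solution's point data and
test functions (`ClassicalEulerPointData`, `ClassicalEulerTestFunctions`, `TorusChainRule`,
`TorusSpaceTimeExtension`), the measure-theoretic assembly of the tested DMV identities
(`YoungMeasureIntegrals`, `MVRelativeEnergyIntegrands`, `MVIntegrandsMeasurability`,
`MVSliceIntegrability`, `MVIdentitiesAveraged`,
`MVRelativeEnergyInequality`), the minimum principle (`MVEntropyMinimum`) and the Gronwall step
(`IntegralGronwallZero` and the first part of this file).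

## References

* J. Březina, E. Feireisl, *Measure-valued solutions to the complete Euler system*,
  J. Math. Soc. Japan 70 (2018) 1227–1245, Theorem 3.3.
-/

noncomputable section

open Set MeasureTheory ProbabilityTheory

namespace Literature.Analysis.FluidPDE

namespace CompressibleEuler

open EulerPhase

/-- **Březina–Feireisl 2018, Theorem 3.3** (weak (measure-valued)–strong uniqueness for the
complete Euler system), as stated in `brezinaFeireisl2018_thm_3_3`.
[cite: BrezinaFeireisl2018, Thm. 3.3] -/
theorem brezinaFeireisl2018_thm_3_3_holds : brezinaFeireisl2018_thm_3_3 := by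
  intro eos hG hS hp2 he2 hs2 he htemp hgrowth T T₁ hT hTT₁ ρ u ϑ h Y D hMV hsupp hY0
  exact weakStrong_core hG hS hp2 he2 hs2 he htemp hgrowth hT hTT₁ h hMV
    (fun z => (hsupp z).mono fun w hw => hw) hY0

end CompressibleEuler

end Literature.Analysis.FluidPDE
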